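import Literature.NumberTheory.ComplexMultiplication.CMTypeRankCommonConstituent
import HarnessLib

/-!
# An element FIXING one slot and CYCLING the conjugate pairs of another: common constituents of the two slots are
# lines carrying a shared sign character; such an element exists for a slot of `2p` embeddings (`p` an odd prime)
# against any slot with fewer than `2p` embeddings

COR-CM (cell `pub-hodgecm2`, seat `b16` gen 46, count-neutral claim PRIME-SLOT, file F1; theorems only, no definition, no
named fact).  NEW as stated, hence under `Summits/`.  Abstract layer of `Literature/…/CMTypeRank` (a group `G` acting slot
by slot on sets `E_i`, a central fixed-point-free involution `ρ`, types `Φ_i` with `IsCMTypeWith ρ (Φ_i)`, antisymmetric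
spans `U(Φ_i) = antiSpan G (Φ_i)`).  Seat p2's pairwise "no common constituent" criterion (`CMTypeRankCommonConstituent`:
for `i ≠ j` no non-zero `G`-stable `P ≤ U(Φ_i)` carries an equivariant `T` into `U(Φ_j)` injective on `P`) has two menus
in the tree, a PARTIAL CONJUGATION (`pairwise_of_partialConj`) and an EIGENVECTOR exclusion for two-element slots
(`pairwise_of_eigenvector`).  This file adds a third mechanism containing the first:

* §1 Let `c ∈ G` CYCLE THE PAIRS of a slot `X` (every `x'` or `ρx'` is some `cⁿx`).  Then the `c`-fixed `ρ`-anti-invariant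
  weights `f : X → ℚ` form a LINE: `f` takes only the values `±f(x₀)` and two such weights are proportional.
* §2 **`pairwise_of_fixing_cycling`** — if `c` FIXES `E_b` pointwise and cycles the pairs of `E_a`, a common constituent
  `P ≤ U(Φ_a)` (either order) is `c`-fixed (equivariance and injectivity of `T`), hence a line `ℚ f₀`, and `G`-stability
  makes `f₀` and `T f₀` eigenvectors for ONE function `χ : G → ℚ`: a SHARED SIGN CHARACTER on the two slots.  So the pair
  satisfies the criterion in both orders as soon as `U(Φ_a)`, `U(Φ_b)` carry no non-zero weights transforming under a
  common `χ` (hypothesis `hno`).  With `c` a partial conjugation the line is `0`: this contains `pairwise_of_partialConj`.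
* §3 **`exists_fixing_cycling_of_prime`** — SUPPLY: if `G` is transitive on `E_a`, `|E_a| = 2p` with `p` an ODD PRIME
  and `|E_b| < 2p`, such a `c` exists: Cauchy's theorem in the (finite) image of `G` in `Sym(E_a) × Sym(E_b)` gives `c`
  acting with order `p`; an element with `cᵖ = 1` moving a point `x₀` of a slot parametrises `2p` DISTINCT points
  `cⁱx₀, ρcⁱx₀` (`i ∈ ℤ/p`, `p` odd: `injective_orbitMap`), so it moves no point of `E_b`, hence moves a point of `E_a`,
  whose orbit and its conjugate then exhaust `E_a`.

Sequels: `CorCM/SharedSignCharacterQuadraticSubfield` (number fields: a shared sign character is the sign of a shared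
imaginary quadratic subfield), `CorCM/PrimeDegreeSlotPairsHodge` (CM fields of degree `2p` against smaller ones).  HONEST
FRAMING: representation-theoretic lemmas on CM types; `HC_CM` is neither used nor asserted.

## References

* [Gordon1999HodgeAVSurvey] B. B. Gordon, *A survey of the Hodge conjecture for abelian varieties*, §3 Theorem, 7.5–7.7.
* [Yanai1985] H. Yanai, *On the rank of CM-type*, Nagoya Math. J. 97 (1985), §3 (an element of order `d`), §4.
* [Dodson1984] B. Dodson, *The structure of Galois groups of CM-fields*, Trans. AMS 283 (1984), §5.1.1 (proof).

Provenance: Literature home (family `hodge`, namespace `Literature.NumberTheory.ComplexMultiplication.FixingCycle`) of the Summits-side `CorCM/FixingCycleSlotPairs` (cell `pub-hodgecm2`, COR-CM; all its imports are `Literature/` and Mathlib), which `Literature/` may not import; theorems only, no named fact, no definition. Nothing here bears on `HC_CM`. Lane `lit-hodgefound` (Layer A3: CM types, their Kubota ranks and Galois combinatorics), seat p20.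
-/

noncomputable section

namespace Literature.NumberTheory.ComplexMultiplication.FixingCycle

open Literature.NumberTheory.ComplexMultiplication

variable {G : Type*} [Group G]

/-! ## §1 The line of `c`-fixed anti-invariant weights on a slot whose pairs `c` cycles -/

section Line

variable {X : Type*} [MulAction G X] {ρ : G} {Ψ : Set X}

/-- Powers of a `c` with `f ∘ c = f` fix `f`. [cite: Gordon1999HodgeAVSurvey, §3 Theorem (proof)] -/
theorem apply_pow_smul_of_comp_eq {c : G} {f : X → ℚ} (hf : ∀ x, f (c • x) = f x) (n : ℕ) (x : X) :
    f (c ^ n • x) = f x := by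
  induction n generalizing x with
  | zero => rw [pow_zero, one_smul]
  | succ n ih => rw [pow_succ, mul_smul, ih, hf]

/-- **A `c`-fixed anti-invariant weight takes only the values `±f(x₀)`** when the powers of `c` reach every point or its
conjugate from `x₀`. [cite: Gordon1999HodgeAVSurvey, §3 Theorem (proof)] -/
theorem apply_eq_or_eq_neg_of_comp_eq (h : IsCMTypeWith ρ Ψ) {c : G}
    (hcyc : ∀ x x' : X, ∃ n : ℕ, c ^ n • x = x' ∨ c ^ n • x = ρ • x') {f : X → ℚ}
    (hanti : ∀ x, f (ρ • x) = -f x) (hfix : ∀ x, f (c • x) = f x) (x₀ x : X) :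
    f x = f x₀ ∨ f x = -f x₀ := by
  obtain ⟨n, hn | hn⟩ := hcyc x₀ x
  · left
    rw [← hn, apply_pow_smul_of_comp_eq hfix]
  · right
    have h1 : f (ρ • x) = f x₀ := by rw [← hn, apply_pow_smul_of_comp_eq hfix]
    rw [hanti] at h1
    have := h.invol x
    linarith

/-- **Two `c`-fixed anti-invariant weights are proportional**: `f₁(x₀) f₂ = f₂(x₀) f₁` — the `c`-fixed part of the
anti-invariant weights is a line. [cite: Gordon1999HodgeAVSurvey, §3 Theorem (proof)] -/
theorem smul_eq_smul_of_comp_eq {c : G}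
    (hcyc : ∀ x x' : X, ∃ n : ℕ, c ^ n • x = x' ∨ c ^ n • x = ρ • x') {f₁ f₂ : X → ℚ}
    (h₁anti : ∀ x, f₁ (ρ • x) = -f₁ x) (h₁fix : ∀ x, f₁ (c • x) = f₁ x)
    (h₂anti : ∀ x, f₂ (ρ • x) = -f₂ x) (h₂fix : ∀ x, f₂ (c • x) = f₂ x) (x₀ : X) :
    f₁ x₀ • f₂ = f₂ x₀ • f₁ := by
  funext x
  simp only [Pi.smul_apply, smul_eq_mul]
  obtain ⟨n, hn | hn⟩ := hcyc x₀ x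
  · rw [← hn, apply_pow_smul_of_comp_eq h₁fix, apply_pow_smul_of_comp_eq h₂fix, mul_comm]
  · have e1 : f₁ (ρ • x) = f₁ x₀ := by rw [← hn, apply_pow_smul_of_comp_eq h₁fix]
    have e2 : f₂ (ρ • x) = f₂ x₀ := by rw [← hn, apply_pow_smul_of_comp_eq h₂fix]
    rw [h₁anti] at e1
    rw [h₂anti] at e2
    have e1' : f₁ x = -f₁ x₀ := by linarith
    have e2' : f₂ x = -f₂ x₀ := by linarith
    rw [e1', e2']
    ring

end Line

/-! ## §2 A fixing–cycling element reduces common constituents to a shared sign character -/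

section Pairwise

variable {I : Type*} {E : I → Type*} [∀ i, MulAction G (E i)]

/-- **A fixing–cycling element excludes common constituents up to a shared sign character, in both orders.**  Let
`c ∈ G` fix `E_b` pointwise and cycle the pairs of `E_a`.  If NO non-zero `f ∈ U(Φ_a)`, `f' ∈ U(Φ_b)` transform under
one and the same `χ : G → ℚ` (`f ∘ g = χ(g) f`, `f' ∘ g = χ(g) f'`), then no non-zero `G`-stable `P ≤ U(Φ_a)` maps
equivariantly and injectively into `U(Φ_b)`, nor vice versa.  (Such a `P` is `c`-fixed — `T(f ∘ c − f) = (Tf) ∘ c − Tf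
= 0` — hence a line `ℚ f₀` by §1, and stability makes `f₀`, `T f₀` eigenvectors of `χ(g) = f₀(g x₀)/f₀(x₀)`.)
[cite: Gordon1999HodgeAVSurvey, §3 Theorem (proof)] -/
theorem pairwise_of_fixing_cycling {ρ : G} {Φ : ∀ i, Set (E i)} (h : ∀ i, IsCMTypeWith ρ (Φ i)) {a b : I}
    {c : G} (hcb : ∀ y : E b, c • y = y)
    (hca : ∀ x x' : E a, ∃ n : ℕ, c ^ n • x = x' ∨ c ^ n • x = ρ • x')
    (hno : ∀ (χ : G → ℚ) (f : E a → ℚ) (f' : E b → ℚ), f ∈ antiSpan G (Φ a) → f' ∈ antiSpan G (Φ b) →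
      (∀ g : G, (fun x => f (g • x)) = χ g • f) → (∀ g : G, (fun y => f' (g • y)) = χ g • f') →
      f ≠ 0 → f' ≠ 0 → False) :
    (∀ P : Submodule ℚ (E a → ℚ), P ≤ antiSpan G (Φ a) →
      (∀ g : G, ∀ f ∈ P, (fun x => f (g • x)) ∈ P) →
      ∀ T : (E a → ℚ) →ₗ[ℚ] (E b → ℚ),
        (∀ g : G, ∀ f ∈ P, T (fun x => f (g • x)) = fun y => T f (g • y)) →
        (∀ f ∈ P, T f ∈ antiSpan G (Φ b)) → (∀ f ∈ P, T f = 0 → f = 0) → P = ⊥) ∧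
    (∀ P : Submodule ℚ (E b → ℚ), P ≤ antiSpan G (Φ b) →
      (∀ g : G, ∀ f ∈ P, (fun x => f (g • x)) ∈ P) →
      ∀ T : (E b → ℚ) →ₗ[ℚ] (E a → ℚ),
        (∀ g : G, ∀ f ∈ P, T (fun x => f (g • x)) = fun y => T f (g • y)) →
        (∀ f ∈ P, T f ∈ antiSpan G (Φ a)) → (∀ f ∈ P, T f = 0 → f = 0) → P = ⊥) := by
  have hantia : ∀ f ∈ antiSpan G (Φ a), ∀ x, f (ρ • x) = -f x := fun f hf x =>
    apply_rho_smul_of_mem_antiSpan (h a) hf x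
  constructor
  · intro P hPU hPst T hTeq hTU hTinj
    by_contra hP
    obtain ⟨f₀, hf₀P, hf₀⟩ := (Submodule.ne_bot_iff P).1 hP
    -- every element of `P` is `c`-fixed
    have hfix : ∀ f ∈ P, ∀ x, f (c • x) = f x := by
      intro f hf
      have h1 : T ((fun x => f (c • x)) - f) = 0 := by
        rw [map_sub, hTeq c f hf, sub_eq_zero]
        funext y
        rw [hcb y]
      have h2 := hTinj _ (Submodule.sub_mem _ (hPst c f hf) hf) h1
      exact fun x => by simpa using congrFun (sub_eq_zero.1 h2) x
    obtain ⟨x₀, hx₀⟩ : ∃ x₀, f₀ x₀ ≠ 0 := by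
      by_contra hall
      push Not at hall
      exact hf₀ (funext hall)
    -- `P` is the line through `f₀`; the character
    set χ : G → ℚ := fun g => f₀ (g • x₀) / f₀ x₀ with hχ
    have heig : ∀ g : G, (fun x => f₀ (g • x)) = χ g • f₀ := by
      intro g
      have hg := hPst g f₀ hf₀P
      have hprop := smul_eq_smul_of_comp_eq hca (hantia f₀ (hPU hf₀P)) (hfix f₀ hf₀P)
        (hantia _ (hPU hg)) (hfix _ hg) x₀
      -- `f₀ x₀ • (f₀ ∘ g) = f₀ (g x₀) • f₀`
      have : (fun x => f₀ (g • x)) = (f₀ x₀)⁻¹ • (f₀ (g • x₀) • f₀) := by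
        rw [← hprop, smul_smul, inv_mul_cancel₀ hx₀, one_smul]
      rw [this, smul_smul]
      simp only [hχ, div_eq_inv_mul]
    have heig' : ∀ g : G, (fun y => T f₀ (g • y)) = χ g • T f₀ := by
      intro g
      rw [← hTeq g f₀ hf₀P, heig g, map_smul]
    have hT0 : T f₀ ≠ 0 := fun h0 => hf₀ (hTinj f₀ hf₀P h0)
    exact hno χ f₀ (T f₀) (hPU hf₀P) (hTU f₀ hf₀P) heig heig' hf₀ hT0
  · intro P hPU hPst T hTeq hTU hTinj
    by_contra hP
    obtain ⟨f₀, hf₀P, hf₀⟩ := (Submodule.ne_bot_iff P).1 hP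
    -- `T f` is `c`-fixed for `f ∈ P`
    have hcomp : ∀ f ∈ P, (fun y => f (c • y)) = f := fun f _ => funext fun y => by rw [hcb y]
    have hfix : ∀ f ∈ P, ∀ x, T f (c • x) = T f x := by
      intro f hf x
      have h1 := hTeq c f hf
      rw [hcomp f hf] at h1
      exact (congrFun h1 x).symm
    have hT0 : T f₀ ≠ 0 := fun h0 => hf₀ (hTinj f₀ hf₀P h0)
    obtain ⟨x₀, hx₀⟩ : ∃ x₀, T f₀ x₀ ≠ 0 := by
      by_contra hall
      push Not at hall
      exact hT0 (funext hall)
    -- `P` is the line through `f₀`: `T f₀ x₀ • f = T f x₀ • f₀`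
    have hline : ∀ f ∈ P, T f₀ x₀ • f = T f x₀ • f₀ := by
      intro f hf
      have hprop := smul_eq_smul_of_comp_eq hca (hantia _ (hTU f₀ hf₀P)) (hfix f₀ hf₀P)
        (hantia _ (hTU f hf)) (hfix f hf) x₀
      have h1 : T (T f₀ x₀ • f - T f x₀ • f₀) = 0 := by
        rw [map_sub, map_smul, map_smul, hprop, sub_self]
      exact sub_eq_zero.1
        (hTinj _ (Submodule.sub_mem _ (Submodule.smul_mem _ _ hf) (Submodule.smul_mem _ _ hf₀P)) h1)
    set χ : G → ℚ := fun g => T f₀ (g • x₀) / T f₀ x₀ with hχ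
    have heig : ∀ g : G, (fun x => f₀ (g • x)) = χ g • f₀ := by
      intro g
      have hg := hPst g f₀ hf₀P
      have h1 := hline _ hg
      have h2 : T (fun x => f₀ (g • x)) x₀ = T f₀ (g • x₀) := by rw [hTeq g f₀ hf₀P]
      rw [h2] at h1
      have : (fun x => f₀ (g • x)) = (T f₀ x₀)⁻¹ • (T f₀ (g • x₀) • f₀) := by
        rw [← h1, smul_smul, inv_mul_cancel₀ hx₀, one_smul]
      rw [this, smul_smul]
      simp only [hχ, div_eq_inv_mul]
    have heig' : ∀ g : G, (fun y => T f₀ (g • y)) = χ g • T f₀ := by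
      intro g
      rw [← hTeq g f₀ hf₀P, heig g, map_smul]
    exact hno χ (T f₀) f₀ (hTU f₀ hf₀P) (hPU hf₀P) heig' heig hT0 hf₀

end Pairwise

/-! ## §3 Existence: a slot of `2p` embeddings, `p` an odd prime, against a slot with fewer embeddings -/

section Existence

variable {X : Type*} [MulAction G X] [Fintype X] {ρ : G} {Ψ : Set X}

omit [Fintype X] in
/-- Powers of `g` on a point only depend on the exponent modulo `p` once `gᵖ` fixes it. [cite: Gordon1999HodgeAVSurvey, §3 Theorem (proof)] -/
theorem pow_smul_eq_pow_mod_smul {g : G} {p : ℕ} {x₀ : X} (hgp : g ^ p • x₀ = x₀) (n : ℕ) :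
    g ^ n • x₀ = g ^ (n % p) • x₀ := by
  have hper : ∀ k : ℕ, g ^ (p * k) • x₀ = x₀ := by
    intro k
    induction k with
    | zero => rw [mul_zero, pow_zero, one_smul]
    | succ k ih => rw [Nat.mul_succ, pow_add, mul_smul, hgp, ih]
  conv_lhs => rw [← Nat.mod_add_div n p, pow_add, mul_smul, hper]

omit [Fintype X] in
/-- Powers of `g` commute with the central involution `ρ`. [cite: Gordon1999HodgeAVSurvey, §3 Theorem (proof)] -/
theorem pow_smul_rho_smul (h : IsCMTypeWith ρ Ψ) (g : G) (n : ℕ) (x : X) : g ^ n • ρ • x = ρ • g ^ n • x := by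
  induction n generalizing x with
  | zero => rw [pow_zero, one_smul, one_smul]
  | succ n ih => rw [pow_succ, mul_smul, mul_smul, h.comm, ih]

omit [Fintype X] in
/-- **`2p` distinct points from one moved point** (`p` an odd prime): if `gᵖ` acts trivially and `g x₀ ≠ x₀`, the points
`gⁱ x₀` and `ρ gⁱ x₀` (`i ∈ ℤ/p`) are pairwise distinct — the orbit of `x₀` has `p` elements and is disjoint from its
conjugate, `ρ` being a fixed-point-free involution commuting with `g` and `p` odd (Dodson's pairing of the `ℤₚ`-orbits).
[cite: Dodson1984, §5.1.1 (proof of the second Proposition)] [cite: Yanai1985, §3] -/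
theorem injective_orbitMap (h : IsCMTypeWith ρ Ψ) {p : ℕ} (hp : p.Prime) (hp2 : p ≠ 2) {g : G}
    (hgp : ∀ x : X, g ^ p • x = x) {x₀ : X} (hx₀ : g • x₀ ≠ x₀) :
    Function.Injective
      (Sum.elim (fun i : ZMod p => g ^ i.val • x₀) (fun i : ZMod p => ρ • g ^ i.val • x₀)) := by
  -- adapted from the tree's `CMTypeRank` §PrimeDegree (Yanai), private there
  haveI : Fact p.Prime := ⟨hp⟩
  haveI : Fact (1 < p) := ⟨hp.one_lt⟩
  set orb : ZMod p → X := fun i => g ^ i.val • x₀ with horb_def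
  have horb : ∀ i, orb i = g ^ i.val • x₀ := fun _ => rfl
  have horb0 : orb 0 = x₀ := by rw [horb, ZMod.val_zero, pow_zero, one_smul]
  have horb_add : ∀ (n : ℕ) (i : ZMod p), g ^ n • orb i = orb ((n : ZMod p) + i) := by
    intro n i
    rw [horb, horb, ← mul_smul, ← pow_add, pow_smul_eq_pow_mod_smul (hgp x₀) (n + i.val), ZMod.val_add,
      ZMod.val_natCast, Nat.mod_add_mod]
  have hcomm_pow : ∀ (n : ℕ) (x : X), g ^ n • ρ • x = ρ • g ^ n • x := pow_smul_rho_smul h g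
  have horb_inj : Function.Injective orb := by
    intro i j hij
    by_contra hne
    have hc : i - j ≠ 0 := sub_ne_zero.2 hne
    have hfix : g ^ (i - j).val • x₀ = x₀ := by
      have e1 := congrArg (fun x => g ^ (-j).val • x) hij
      simp only [horb_add, ZMod.natCast_zmod_val, neg_add_eq_sub, sub_self, horb0] at e1
      rw [horb] at e1
      exact e1
    have hfixm : ∀ m : ℕ, g ^ ((i - j).val * m) • x₀ = x₀ := by
      intro m
      induction m with
      | zero => rw [mul_zero, pow_zero, one_smul]
      | succ m ih => rw [Nat.mul_succ, pow_add, mul_smul, hfix, ih]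
    apply hx₀
    have e2 := hfixm (i - j)⁻¹.val
    rw [pow_smul_eq_pow_mod_smul (hgp x₀)] at e2
    have e3 : ((i - j).val * (i - j)⁻¹.val) % p = 1 := by
      have e4 : (((i - j).val * (i - j)⁻¹.val : ℕ) : ZMod p) = 1 := by
        rw [Nat.cast_mul, ZMod.natCast_zmod_val, ZMod.natCast_zmod_val, mul_inv_cancel₀ hc]
      have e5 := congrArg ZMod.val e4
      rwa [ZMod.val_natCast, ZMod.val_one] at e5
    rw [e3, pow_one] at e2
    exact e2
  have hcross : ∀ i j : ZMod p, orb i ≠ ρ • orb j := by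
    intro i j hij
    have e1 : orb (i - j) = ρ • x₀ := by
      have e := congrArg (fun x => g ^ (-j).val • x) hij
      simp only [horb_add, hcomm_pow, ZMod.natCast_zmod_val, neg_add_eq_sub, sub_self, horb0] at e
      exact e
    have e2 : orb (((i - j).val : ZMod p) + (i - j)) = x₀ := by
      rw [← horb_add, e1, hcomm_pow, ← horb (i - j), e1, h.invol]
    rw [ZMod.natCast_zmod_val, ← horb0] at e2
    have e3 : (2 : ZMod p) * (i - j) = 0 := by rw [two_mul]; exact horb_inj e2
    have h2 : (2 : ZMod p) ≠ 0 := by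
      intro h0
      have h0' : ((2 : ℕ) : ZMod p) = 0 := by exact_mod_cast h0
      rw [ZMod.natCast_eq_zero_iff] at h0'
      rcases Nat.prime_two.eq_one_or_self_of_dvd p h0' with h1 | h1
      · exact hp.one_lt.ne' h1
      · exact hp2 h1
    have hk0 : i - j = 0 := (mul_eq_zero.1 e3).resolve_left h2
    rw [hk0, horb0] at e1
    exact h.rho_smul_ne x₀ e1.symm
  have hρinj : Function.Injective fun x : X => ρ • x := fun x y hxy => by
    simpa [h.invol] using congrArg (fun z => ρ • z) hxy
  rintro (i | i) (j | j) hij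
  · simp only [Sum.elim_inl] at hij
    rw [horb_inj hij]
  · simp only [Sum.elim_inl, Sum.elim_inr] at hij
    exact absurd hij (hcross i j)
  · simp only [Sum.elim_inl, Sum.elim_inr] at hij
    exact absurd hij.symm (hcross j i)
  · simp only [Sum.elim_inr] at hij
    rw [horb_inj (hρinj hij)]

/-- Hence **an element with `gᵖ = 1` (`p` an odd prime) that moves a point of a slot forces `2p ≤ |slot|`**.
[cite: Dodson1984, §5.1.1 (proof of the second Proposition)] -/
theorem two_mul_le_card_of_smul_ne (h : IsCMTypeWith ρ Ψ) {p : ℕ} (hp : p.Prime) (hp2 : p ≠ 2) {g : G}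
    (hgp : ∀ x : X, g ^ p • x = x) {x₀ : X} (hx₀ : g • x₀ ≠ x₀) : 2 * p ≤ Fintype.card X := by
  classical
  haveI : Fact p.Prime := ⟨hp⟩
  have := Fintype.card_le_of_injective _ (injective_orbitMap h hp hp2 hgp hx₀)
  rwa [Fintype.card_sum, ZMod.card, ← two_mul] at this

/-- … and **on a slot with exactly `2p` points the orbit of the moved point and its conjugate exhaust the slot**: every
`x, x'` are linked by a power of `g` up to `ρ` (`gⁿ x = x'` or `gⁿ x = ρ x'`). [cite: Yanai1985, §3–§4] -/
theorem forall_exists_pow_smul_of_card_eq (h : IsCMTypeWith ρ Ψ) {p : ℕ} (hp : p.Prime) (hp2 : p ≠ 2) {g : G}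
    (hgp : ∀ x : X, g ^ p • x = x) {x₀ : X} (hx₀ : g • x₀ ≠ x₀) (hcard : Fintype.card X = 2 * p)
    (x x' : X) : ∃ n : ℕ, g ^ n • x = x' ∨ g ^ n • x = ρ • x' := by
  classical
  haveI : Fact p.Prime := ⟨hp⟩
  set ψ := Sum.elim (fun i : ZMod p => g ^ i.val • x₀) (fun i : ZMod p => ρ • g ^ i.val • x₀) with hψ
  have hψsurj : Function.Surjective ψ :=
    ((Fintype.bijective_iff_injective_and_card ψ).2
      ⟨injective_orbitMap h hp hp2 hgp hx₀, by rw [Fintype.card_sum, ZMod.card, hcard, two_mul]⟩).2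
  have hcomm_pow : ∀ (n : ℕ) (y : X), g ^ n • ρ • y = ρ • g ^ n • y := pow_smul_rho_smul h g
  -- `g^{(j - i).val}` carries `gⁱ x₀` to `gʲ x₀`
  have hstep : ∀ i j : ZMod p, g ^ (j - i).val • g ^ i.val • x₀ = g ^ j.val • x₀ := by
    intro i j
    rw [← mul_smul, ← pow_add, pow_smul_eq_pow_mod_smul (hgp x₀), ← ZMod.val_add, sub_add_cancel]
  obtain ⟨u, rfl⟩ := hψsurj x
  obtain ⟨v, rfl⟩ := hψsurj x'
  rcases u with i | i <;> rcases v with j | j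
  · exact ⟨(j - i).val, Or.inl (by simp only [hψ, Sum.elim_inl, hstep])⟩
  · exact ⟨(j - i).val, Or.inr (by simp only [hψ, Sum.elim_inl, Sum.elim_inr, hstep, h.invol])⟩
  · refine ⟨(j - i).val, Or.inr ?_⟩
    simp only [hψ, Sum.elim_inl, Sum.elim_inr, hcomm_pow, hstep]
  · refine ⟨(j - i).val, Or.inl ?_⟩
    simp only [hψ, Sum.elim_inr, hcomm_pow, hstep]

variable {I : Type*} {E : I → Type*} [∀ i, MulAction G (E i)]

/-- **Existence of a fixing–cycling element.**  Let `G` act transitively on `E_a` with `|E_a| = 2p`, `p` an ODD PRIME,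
and let `|E_b| < 2p` (both slots carrying types for the central involution `ρ`).  Then some `c ∈ G` FIXES `E_b`
pointwise and CYCLES THE PAIRS of `E_a`.  Proof: `2p = |E_a|` divides the order of the image `R` of `G` in
`Sym(E_a) × Sym(E_b)` (orbit–stabiliser), so Cauchy gives `c` acting with order `p`; by `two_mul_le_card_of_smul_ne` it
moves no point of `E_b`, hence moves a point of `E_a`, and `forall_exists_pow_smul_of_card_eq` applies.
[cite: Yanai1985, §3 (p. 170)] [cite: Dodson1984, §5.1.1] -/
theorem exists_fixing_cycling_of_prime {Φ : ∀ i, Set (E i)} (h : ∀ i, IsCMTypeWith ρ (Φ i)) {a b : I}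
    [Fintype (E a)] [Fintype (E b)] [MulAction.IsPretransitive G (E a)] {p : ℕ} (hp : p.Prime) (hp2 : p ≠ 2)
    (ha : Fintype.card (E a) = 2 * p) (hb : Fintype.card (E b) < 2 * p) :
    ∃ c : G, (∀ y : E b, c • y = y) ∧ ∀ x x' : E a, ∃ n : ℕ, c ^ n • x = x' ∨ c ^ n • x = ρ • x' := by
  classical
  haveI : Fact p.Prime := ⟨hp⟩
  obtain ⟨x₀⟩ : Nonempty (E a) := by rw [← Fintype.card_pos_iff, ha]; have := hp.pos; omega
  let θ : G →* Equiv.Perm (E a) × Equiv.Perm (E b) := (MulAction.toPermHom G (E a)).prod (MulAction.toPermHom G (E b))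
  have hθ1 : ∀ (g : G) (x : E a), (θ g).1 x = g • x := fun g x => rfl
  have hθ2 : ∀ (g : G) (y : E b), (θ g).2 y = g • y := fun g y => rfl
  -- the image `R` acts transitively on `E_a` through the first projection
  letI : MulAction θ.range (E a) :=
    MulAction.compHom (E a) ((MonoidHom.fst (Equiv.Perm (E a)) (Equiv.Perm (E b))).comp θ.range.subtype)
  have hsmul : ∀ (r : θ.range) (x : E a), r • x = (r : Equiv.Perm (E a) × Equiv.Perm (E b)).1 x := fun _ _ => rfl
  haveI : MulAction.IsPretransitive θ.range (E a) := ⟨fun x y => by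
    obtain ⟨g, hg⟩ := MulAction.exists_smul_eq G x y
    exact ⟨⟨θ g, g, rfl⟩, by rw [hsmul]; exact hg⟩⟩
  have hdvd : p ∣ Nat.card θ.range := by
    have h1 := (MulAction.stabilizer θ.range x₀).index_mul_card
    rw [MulAction.index_stabilizer_of_transitive, Nat.card_eq_fintype_card, ha] at h1
    exact Dvd.intro (2 * Nat.card (MulAction.stabilizer θ.range x₀)) (by rw [← h1]; ring)
  obtain ⟨σ, hσ⟩ := exists_prime_orderOf_dvd_card' p hdvd
  obtain ⟨g, hg⟩ := MonoidHom.mem_range.1 σ.2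
  have hord : orderOf (θ g) = p := by rw [hg, Subgroup.orderOf_coe, hσ]
  have hpow : θ (g ^ p) = 1 := by rw [map_pow, ← hord, pow_orderOf_eq_one]
  have hgpa : ∀ x : E a, g ^ p • x = x := fun x => by rw [← hθ1 (g ^ p) x, hpow]; rfl
  have hgpb : ∀ y : E b, g ^ p • y = y := fun y => by rw [← hθ2 (g ^ p) y, hpow]; rfl
  -- `g` fixes `E_b` (else `2p ≤ |E_b|`)
  have hfixb : ∀ y : E b, g • y = y := fun y => by
    by_contra hy
    exact absurd (two_mul_le_card_of_smul_ne (h b) hp hp2 hgpb hy) (not_le.2 hb)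
  -- `g` moves a point of `E_a` (else `θ g = 1`)
  obtain ⟨x₁, hx₁⟩ : ∃ x₁ : E a, g • x₁ ≠ x₁ := by
    by_contra hall
    push Not at hall
    have h1 : θ g = 1 := by
      refine Prod.ext (Equiv.ext fun x => ?_) (Equiv.ext fun y => ?_)
      · rw [hθ1]; exact hall x
      · rw [hθ2]; exact hfixb y
    rw [h1, orderOf_one] at hord
    exact hp.one_lt.ne hord
  exact ⟨g, hfixb, forall_exists_pow_smul_of_card_eq (h a) hp hp2 hgpa hx₁ ha⟩

end Existence

end Literature.NumberTheory.ComplexMultiplication.FixingCycle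

end
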